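import Mathlib
import Summits.CriticalPhenomena.PercolationContinuityZ3.Theorems.PercNearOneGluingNoHeavyLowerTailDeltaMS
import Summits.CriticalPhenomena.PercolationContinuityZ3.Theorems.PercNearOneGluingNoHeavyLowerTailHexMSDelta

/-!
# Δ-HEX for at most two adjacent axes, and the two-colour form (H2) — corollaries of Δ-MS

Support file for crux `stmt-CriticalPhenomena-4575` (`NoHeavyLowerTail`, route `PercNearOneGluingNoHeavy`), hull-port seat `prim-hp-7`
(generation 66); `--supports stmt-CriticalPhenomena-4575`.  No `sorry`.  Memo: `run/shared/lean/prim/prim-hp-7/FROM-prim-hp-7-g66-DELTA-MS-PROOF.md`.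

* `deltaHexRel_of_adjacent`, `deltaHexRel_of_oneAxis`: g65's conjecture **Δ-HEX** (`DeltaHexRel`: the far meets and far joins `symGen U 𝒟 x`
  of an antipodal ℤ₆-labelled instance number at least `#𝒟`) holds whenever the labels lie on at most two ADJACENT antipodal axes
  (`x a ∈ {i, i+1, i+3, i+4}`), in particular for one axis (g65's "Δ-MS"): the half `F = {a ∈ 𝒟 : x a ∈ {i, i+1}}` is pairwise close, so
  `F \\ F ⊆ gen 𝒟 x`, `𝒟 ⊆ F ∪ co F`, and the projective Marica–Schönheim inequality `#(F ∪ co F) ≤ #((F \\ F) ∪ co (F \\ F))`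
  (`card_cl_le_card_cl_diffs`, …LowerTailDeltaMS) finishes.
* `card_add_card_le_card_twoColour`: the two-colour form **(H2)** — for disjoint families `X, Y` of subsets of `U` (with a spare point `r ∉ U`),
  `#X + #Y ≤ #(X \\ X ∪ Y \\ Y ∪ X ⊼ Y ∪ X ⊻ Y)` (differences within each colour, meets and joins across), by lifting `Y` to
  `{insert r (U \ y)}` and applying `two_mul_card_le_card_cl_diffs`.
Three axes (HEX-MS proper) remain open; see the memo for why the per-direction method stops exactly there.
-/

namespace Summit.CriticalPhenomena.PercolationContinuityZ3.Theorems

namespace GeneratedDonors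

open Finset FinsetFamily

variable {α : Type*} [DecidableEq α]

/-- **Δ-HEX holds for instances labelled with at most two ADJACENT axes** (`x a ∈ {i, i+1, i+3, i+4}` on `𝒟`): the half
`F = {a ∈ 𝒟 : x a ∈ {i, i+1}}` consists of pairwise close members, `𝒟 = F ∪ co F`, `F \\ F ⊆ gen 𝒟 x`, and Δ-MS
(`card_cl_le_card_cl_diffs`) gives `#𝒟 ≤ #cl (F \\ F) ≤ #(symGen U 𝒟 x)`.  This is the Δ-strength version of g64's `hexMSAt_of_adjacent`
and settles g65's 'Δ-MS' (one axis) and '(H2)' (two adjacent axes) cases of Conjecture Δ-HEX. -/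
theorem deltaHexRel_of_adjacent (U : Finset α) (𝒟 : Finset (Finset α)) (x : Finset α → ZMod 6) (i : ZMod 6)
    (hlab : ∀ a ∈ 𝒟, x a = i ∨ x a = i + 1 ∨ x a = i + 3 ∨ x a = i + 4) : DeltaHexRel U 𝒟 x := by
  intro hU hco hanti
  classical
  set F : Finset (Finset α) := 𝒟.filter fun a => x a = i ∨ x a = i + 1 with hF
  have hFU : ∀ f ∈ F, f ⊆ U := fun f hf => hU f (mem_filter.mp hf).1
  -- 𝒟 ⊆ F ∪ co F
  have key : ∀ j s : ZMod 6, (s = j + 3 ∨ s = j + 4) → (s + 3 = j ∨ s + 3 = j + 1) := by decide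
  have hD : 𝒟 ⊆ F ∪ F.image fun f => U \ f := by
    intro a ha
    rw [mem_union, mem_image]
    by_cases h : x a = i ∨ x a = i + 1
    · exact Or.inl (mem_filter.mpr ⟨ha, h⟩)
    · right
      refine ⟨U \ a, mem_filter.mpr ⟨hco a ha, ?_⟩, Finset.sdiff_sdiff_eq_self (hU a ha)⟩
      rw [hanti a ha]
      rcases hlab a ha with h1 | h1 | h1 | h1
      · exact absurd (Or.inl h1) h
      · exact absurd (Or.inr h1) h
      · exact key i (x a) (Or.inl h1)
      · exact key i (x a) (Or.inr h1)
  -- cl (F \\ F) ⊆ symGen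
  have hgen : F \\ F ⊆ gen 𝒟 x := by
    rw [diffs_subset_iff]
    intro a ha b hb
    rw [hF, mem_filter] at ha hb
    exact mem_gen.mpr ⟨a, ha.1, b, hb.1, close_of_mem_pair ha.2 hb.2, rfl⟩
  have hcl : (F \\ F) ∪ (F \\ F).image (fun z => U \ z) ⊆ symGen U 𝒟 x := by
    intro s hs
    unfold symGen
    rw [mem_union, mem_image] at hs ⊢
    rcases hs with h | ⟨z, hz, rfl⟩
    · exact Or.inl (hgen h)
    · exact Or.inr ⟨z, hgen hz, rfl⟩
  calc #𝒟 ≤ #(F ∪ F.image fun f => U \ f) := card_le_card hD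
    _ ≤ #((F \\ F) ∪ (F \\ F).image fun z => U \ z) := card_cl_le_card_cl_diffs U F hFU
    _ ≤ #(symGen U 𝒟 x) := card_le_card hcl

/-- **Δ-HEX for one antipodal axis** (`x a ∈ {i, i+3}` on `𝒟`) — g65's 'Δ-MS' in the conjecture's own vocabulary. -/
theorem deltaHexRel_of_oneAxis (U : Finset α) (𝒟 : Finset (Finset α)) (x : Finset α → ZMod 6) (i : ZMod 6)
    (hlab : ∀ a ∈ 𝒟, x a = i ∨ x a = i + 3) : DeltaHexRel U 𝒟 x :=
  deltaHexRel_of_adjacent U 𝒟 x i fun a ha => (hlab a ha).elim Or.inl fun h => Or.inr (Or.inr (Or.inl h))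

/-- **(H2): two far colours** (g65's 'first target for gen 66', equivalent to Δ-MS).  For disjoint families `X, Y` of subsets of `U`
(and a point `r ∉ U` available in the type): `#X + #Y ≤ #(X \\ X ∪ Y \\ Y ∪ X ⊼ Y ∪ X ⊻ Y)` — differences within each colour, meets AND joins
across.  Proof: put `F := X ∪ {insert r (U \ y) : y ∈ Y}` (complement-free in `insert r U` because `X ∩ Y = ∅`); deleting `r`, every member of
`F \\ F` or of its complement family is a member of `T := X \\ X ∪ Y \\ Y ∪ X ⊼ Y ∪ X ⊻ Y` or the lift `insert r (U \ t)` of one, so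
`2 (#X + #Y) = 2 #F ≤ #cl(F \\ F) ≤ 2 #T` by `two_mul_card_le_card_cl_diffs`. -/
theorem card_add_card_le_card_twoColour (U : Finset α) (r : α) (hr : r ∉ U) (X Y : Finset (Finset α))
    (hX : ∀ x ∈ X, x ⊆ U) (hY : ∀ y ∈ Y, y ⊆ U) (hXY : Disjoint X Y) :
    #X + #Y ≤ #((X \\ X ∪ Y \\ Y) ∪ (X ⊼ Y ∪ X ⊻ Y)) := by
  classical
  set T : Finset (Finset α) := (X \\ X ∪ Y \\ Y) ∪ (X ⊼ Y ∪ X ⊻ Y) with hT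
  set V : Finset α := insert r U with hV
  set F : Finset (Finset α) := X ∪ Y.image (fun y => insert r (U \ y)) with hF
  have hXr : ∀ x ∈ X, r ∉ x := fun x hx h => hr (hX x hx h)
  have hYr : ∀ y ∈ Y, r ∉ y := fun y hy h => hr (hY y hy h)
  have hrU : ∀ s : Finset α, r ∉ U \ s := fun s h => hr (mem_sdiff.mp h).1
  have hFV : ∀ f ∈ F, f ⊆ V := by
    intro f hf
    rcases mem_union.mp hf with h | h
    · exact (hX f h).trans (subset_insert r U)
    · obtain ⟨y, _, rfl⟩ := mem_image.mp h
      exact insert_subset_insert r sdiff_subset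
  have hTU : ∀ t ∈ T, t ⊆ U := by
    intro t ht
    rw [hT, mem_union, mem_union, mem_union, mem_diffs, mem_diffs, mem_infs, mem_sups] at ht
    rcases ht with (⟨a, ha, b, _, rfl⟩ | ⟨a, ha, b, _, rfl⟩) | (⟨a, ha, b, _, rfl⟩ | ⟨a, ha, b, hb, rfl⟩)
    · exact sdiff_subset.trans (hX a ha)
    · exact sdiff_subset.trans (hY a ha)
    · exact inf_le_left.trans (hX a ha)
    · exact sup_le (hX a ha) (hY b hb)
  -- the lift s ↦ insert r (U \ s) is injective on subsets of U
  have hlift : ∀ {s s' : Finset α}, s ⊆ U → s' ⊆ U → insert r (U \ s) = insert r (U \ s') → s = s' := by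
    intro s s' hs hs' h
    have h2 : U \ s = U \ s' := by
      have h3 : (insert r (U \ s)).erase r = (insert r (U \ s')).erase r := by rw [h]
      rw [erase_insert (hrU s), erase_insert (hrU s')] at h3
      exact h3
    rw [← Finset.sdiff_sdiff_eq_self hs, ← Finset.sdiff_sdiff_eq_self hs', h2]
  have hinj : Set.InjOn (fun y : Finset α => insert r (U \ y)) (Y : Set (Finset α)) :=
    fun y hy y' hy' h => hlift (hY y (mem_coe.mp hy)) (hY y' (mem_coe.mp hy')) h
  have hdisj : Disjoint X (Y.image fun y => insert r (U \ y)) := by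
    rw [disjoint_left]
    intro x hx hx'
    obtain ⟨y, _, hyx⟩ := mem_image.mp hx'
    exact hXr x hx (hyx ▸ mem_insert_self r _)
  have hcardF : #F = #X + #Y := by
    rw [hF, card_union_of_disjoint hdisj, card_image_of_injOn hinj]
  -- F is complement-free in V
  have hfree : ∀ f ∈ F, V \ f ∉ F := by
    intro f hf hcf
    rcases mem_union.mp hf with h | h
    · rcases mem_union.mp hcf with h' | h'
      · exact hXr _ h' (mem_sdiff.mpr ⟨mem_insert_self r U, hXr f h⟩)
      · obtain ⟨y, hy, hyf⟩ := mem_image.mp h'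
        have hVf : V \ f = insert r (U \ f) := by rw [hV]; exact Finset.insert_sdiff_of_notMem U (hXr f h)
        have : y = f := hlift (hY y hy) (hX f h) (hyf.trans hVf)
        exact disjoint_left.mp hXY h (this ▸ hy)
    · obtain ⟨y, hy, rfl⟩ := mem_image.mp h
      have hVy : V \ insert r (U \ y) = y := by
        rw [hV, insertGround_sdiff_insert hr, Finset.sdiff_sdiff_eq_self (hY y hy)]
      rw [hVy] at hcf
      rcases mem_union.mp hcf with h' | h'
      · exact disjoint_left.mp hXY h' hy
      · obtain ⟨y', _, hy'y⟩ := mem_image.mp h'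
        exact hYr y hy (hy'y ▸ mem_insert_self r _)
  -- every difference is in T (if r-free) or is the lift of a member of T
  have hT1 : ∀ {s}, s ∈ X \\ X ∪ Y \\ Y → s ∈ T := fun h => by rw [hT, mem_union]; exact Or.inl h
  have hT2 : ∀ {s}, s ∈ X ⊼ Y ∪ X ⊻ Y → s ∈ T := fun h => by rw [hT, mem_union]; exact Or.inr h
  have key : ∀ z ∈ F \\ F, z ∈ T ∨ ∃ t ∈ T, insert r (U \ t) = z := by
    intro z hz
    rw [mem_diffs] at hz
    obtain ⟨a, ha, b, hb, rfl⟩ := hz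
    rcases mem_union.mp ha with haX | haY <;> rcases mem_union.mp hb with hbX | hbY
    · exact Or.inl (hT1 (mem_union.mpr (Or.inl (mem_diffs.mpr ⟨a, haX, b, hbX, rfl⟩))))
    · -- a \ insert r (U \ y) = a ∩ y
      obtain ⟨y, hy, rfl⟩ := mem_image.mp hbY
      left
      have : a \ insert r (U \ y) = a ⊓ y := by
        ext i; simp only [mem_sdiff, mem_insert, inf_eq_inter, mem_inter, not_or]
        constructor
        · rintro ⟨hi, _, h2⟩
          refine ⟨hi, ?_⟩
          by_contra hiy
          exact h2 ⟨hX a haX hi, hiy⟩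
        · rintro ⟨hi, hiy⟩
          refine ⟨hi, ?_, ?_⟩
          · rintro rfl; exact hXr a haX hi
          · rintro ⟨_, h⟩; exact h hiy
      rw [this]
      exact hT2 (mem_union.mpr (Or.inl (mem_infs.mpr ⟨a, haX, y, hy, rfl⟩)))
    · -- insert r (U \ y) \ b = insert r (U \ (b ∪ y)), the lift of b ⊔ y ∈ X ⊻ Y
      obtain ⟨y, hy, rfl⟩ := mem_image.mp haY
      right
      refine ⟨b ⊔ y, hT2 (mem_union.mpr (Or.inr (mem_sups.mpr ⟨b, hbX, y, hy, rfl⟩))), ?_⟩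
      ext i
      simp only [mem_insert, mem_sdiff, sup_eq_union, mem_union, not_or]
      constructor
      · rintro (rfl | ⟨hi, hb', hy'⟩)
        · exact ⟨Or.inl rfl, hXr b hbX⟩
        · exact ⟨Or.inr ⟨hi, hy'⟩, hb'⟩
      · rintro ⟨rfl | ⟨hi, hy'⟩, hb'⟩
        · exact Or.inl rfl
        · exact Or.inr ⟨hi, hb', hy'⟩
    · -- insert r (U \ y) \ insert r (U \ y') = y' \ y
      obtain ⟨y, hy, rfl⟩ := mem_image.mp haY
      obtain ⟨y', hy', rfl⟩ := mem_image.mp hbY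
      left
      have : insert r (U \ y) \ insert r (U \ y') = y' \ y := by
        ext i; simp only [mem_sdiff, mem_insert, not_or]
        constructor
        · rintro ⟨h1, h2, h3⟩
          rcases h1 with rfl | ⟨hiU, hiy⟩
          · exact absurd rfl h2
          · refine ⟨?_, hiy⟩
            by_contra hi
            exact h3 ⟨hiU, hi⟩
        · rintro ⟨h1, h2⟩
          refine ⟨Or.inr ⟨hY y' hy' h1, h2⟩, ?_, ?_⟩
          · rintro rfl; exact hYr y' hy' h1
          · rintro ⟨_, h3⟩; exact h3 h1
      rw [this]
      exact hT1 (mem_union.mpr (Or.inr (mem_diffs.mpr ⟨y', hy', y, hy, rfl⟩)))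
  have hsub : (F \\ F) ∪ (F \\ F).image (fun z => V \ z) ⊆ T ∪ T.image fun t => insert r (U \ t) := by
    intro z hz
    rw [mem_union] at hz ⊢
    rw [mem_image]
    rcases hz with hz | hz
    · rcases key z hz with h | ⟨t, ht, rfl⟩
      · exact Or.inl h
      · exact Or.inr ⟨t, ht, rfl⟩
    · obtain ⟨z', hz', rfl⟩ := mem_image.mp hz
      rcases key z' hz' with h | ⟨t, ht, rfl⟩
      · right
        refine ⟨z', h, ?_⟩
        rw [hV]; exact (Finset.insert_sdiff_of_notMem U (fun h' => hr (hTU z' h h'))).symm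
      · left
        rw [hV, insertGround_sdiff_insert hr, Finset.sdiff_sdiff_eq_self (hTU t ht)]
        exact ht
  have h1 := two_mul_card_le_card_cl_diffs V F hFV hfree
  have h2 := card_le_card hsub
  have h3 : #(T ∪ T.image fun t => insert r (U \ t)) ≤ #T + #T :=
    (card_union_le _ _).trans (Nat.add_le_add_left card_image_le _)
  omega

end GeneratedDonors

end Summit.CriticalPhenomena.PercolationContinuityZ3.Theorems
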